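import Mathlib
import Summits.ValiantsHypothesis.ValiantsHypothesis.Theses.FreeFermionCLL
import Summits.ValiantsHypothesis.ValiantsHypothesis.Theses.PrincipalMinorColouring
import Literature.Computability.AlgebraicComplexity.DeterminantalComplexityProofs
import Literature.Computability.AlgebraicComplexity.PrincipalMinorRepr
import Literature.Computability.AlgebraicComplexity.LRPencilOfMatrix

/-!
# `TotalRankLeDc` — principal-minor normal form of size `≤ n² · dc(per_n)`

Route `ValiantsHypothesis/FreeFermionCLL` (shared verbatim with `PrincipalMinorColouring`),
item `stmt-ValiantsHypothesis-3784`.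

For every `n` there is a principal-minor representation
`per_n(x + J) = n! · det(I_R + diag(x ∘ κ) K)` of size `R = n² · dc(per_n)`:
take an affine determinantal representation `A` of `per_n` of size `m = dc(per_n)`
(`hasDetRepr_determinantalComplexity_holds`), shift `x ↦ x + J`, split the shifted matrix as
`B + Σ_e x_e A_e` with `B = A(J)`, `det B = per_n(J) = n! ≠ 0`, factor out `B` and apply the
Weinstein–Aronszajn identity `det(1 + U W) = det(1 + W U)` (`Matrix.det_one_add_mul_comm`) to
`Σ_e x_e B⁻¹A_e = U · W` with `U ∈ ℂ^{m × (n²m)}`, `W = (x_e δ_{jk})`; finally reindex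
`(Fin n × Fin n) × Fin m ≃ Fin (n² m)`.
-/

-- single-conjunct layout: Sub = Summit, duplicated namespace component intended
set_option linter.dupNamespace false

namespace Summit.ValiantsHypothesis.ValiantsHypothesis.Theorems

open MvPolynomial Matrix Literature.Computability.AlgebraicComplexity

namespace FreeFermionCLLTotalRankLeDc

/-- **Weinstein–Aronszajn / Sylvester normal form of a linear matrix pencil at the identity.**
For constant square matrices `Cm e` (`e : σ`) of size `m`,
`det(1 + Σ_e x_e · Cm e) = det(1 + diag(x_{p.1}) · K)` over the index set `σ × Fin m`, where
`K (p, q) = (Cm q.1) p.2 q.2`: write `Σ_e x_e Cm e = U · W` with `U i (e, j) = (Cm e) i j`,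
`W (e, j) k = x_e δ_{jk}` and use `det(1 + U W) = det(1 + W U)`. [folklore] -/
theorem det_one_add_sum_X_smul_map_C {R σ : Type*} [CommRing R] [Fintype σ] [DecidableEq σ]
    {m : ℕ} (Cm : σ → Matrix (Fin m) (Fin m) R) :
    (1 + ∑ e, (X e : MvPolynomial σ R) • (Cm e).map C).det =
      (1 + Matrix.diagonal (fun p : σ × Fin m => (X p.1 : MvPolynomial σ R)) *
        (Matrix.of fun p q : σ × Fin m => Cm q.1 p.2 q.2).map C).det := by
  set U : Matrix (Fin m) (σ × Fin m) (MvPolynomial σ R) :=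
    Matrix.of fun i p => C (Cm p.1 i p.2) with hU
  set W : Matrix (σ × Fin m) (Fin m) (MvPolynomial σ R) :=
    Matrix.of fun p k => if p.2 = k then X p.1 else 0 with hW
  have hUW : U * W = ∑ e, (X e : MvPolynomial σ R) • (Cm e).map C := by
    ext i k : 1
    rw [Matrix.mul_apply, Matrix.sum_apply, Fintype.sum_prod_type]
    refine Finset.sum_congr rfl fun e _ => ?_
    simp only [hU, hW, Matrix.of_apply, mul_ite, mul_zero, Finset.sum_ite_eq', Finset.mem_univ,
      if_true, Matrix.smul_apply, Matrix.map_apply, smul_eq_mul]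
    exact mul_comm _ _
  have hWU : W * U = Matrix.diagonal (fun p : σ × Fin m => (X p.1 : MvPolynomial σ R)) *
      (Matrix.of fun p q : σ × Fin m => Cm q.1 p.2 q.2).map C := by
    ext p q : 1
    rw [Matrix.diagonal_mul, Matrix.mul_apply, Matrix.map_apply, Matrix.of_apply]
    simp only [hU, hW, Matrix.of_apply, ite_mul, zero_mul, Finset.sum_ite_eq, Finset.mem_univ,
      if_true]
  rw [← hUW, Matrix.det_one_add_mul_comm, hWU]

/-- **Shift of an affine polynomial.** If `p` has total degree `≤ 1` then
`p(x + J) = p(J) + Σ_v x_v · coeff_{x_v} p`. [folklore] -/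
theorem aeval_X_add_one_of_totalDegree_le_one {R σ : Type*} [CommRing R] [Fintype σ]
    (p : MvPolynomial σ R) (hp : p.totalDegree ≤ 1) :
    aeval (fun e => (X e + 1 : MvPolynomial σ R)) p =
      C (eval (fun _ => (1 : R)) p) + ∑ v, X v * C (coeff (Finsupp.single v 1) p) := by
  have h := LRPencil.eq_affine_of_totalDegree_le_one p hp
  have h1 : aeval (fun e => (X e + 1 : MvPolynomial σ R)) p =
      C (coeff 0 p) + ∑ v, C (coeff (Finsupp.single v 1) p) * (X v + 1) := by
    conv_lhs => rw [h]
    simp only [map_add, map_sum, map_mul, aeval_C, algebraMap_eq, aeval_X]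
  have h2 : eval (fun _ => (1 : R)) p = coeff 0 p + ∑ v, coeff (Finsupp.single v 1) p := by
    conv_lhs => rw [h]
    simp only [map_add, map_sum, map_mul, eval_C, eval_X, mul_one]
  rw [h1, h2, map_add, map_sum]
  simp only [mul_add, mul_one, Finset.sum_add_distrib]
  have h3 : ∑ v, C (coeff (Finsupp.single v 1) p) * X v =
      ∑ v, X v * C (coeff (Finsupp.single v 1) p) :=
    Finset.sum_congr rfl fun v _ => mul_comm _ _
  rw [h3]
  ring

/-- **Shift of an affine matrix.** For a matrix `A` of affine entries,
`A(x + J) = A(J) + Σ_e x_e · A_e` with `A_e` the coefficient matrix of `x_e`. [folklore] -/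
theorem map_aeval_X_add_one_of_totalDegree_le_one {R σ : Type*} [CommRing R] [Fintype σ]
    {m : ℕ} (A : Matrix (Fin m) (Fin m) (MvPolynomial σ R)) (hA : ∀ i j, (A i j).totalDegree ≤ 1) :
    A.map (aeval fun e => (X e + 1 : MvPolynomial σ R)) =
      (A.map (eval fun _ => (1 : R))).map C +
        ∑ e, (X e : MvPolynomial σ R) • (A.map (coeff (Finsupp.single e 1))).map C := by
  ext i j : 1
  rw [Matrix.map_apply, aeval_X_add_one_of_totalDegree_le_one _ (hA i j), Matrix.add_apply,
    Matrix.sum_apply]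
  simp only [Matrix.map_apply, Matrix.smul_apply, smul_eq_mul]

/-- `per_n(J) = n!`: the permanent of the all-ones matrix counts the permutations. [folklore] -/
theorem eval_one_perPoly (n : ℕ) :
    eval (fun _ => (1 : ℂ)) (perPoly (Fin n) ℂ) = (n.factorial : ℂ) := by
  rw [eval_perPoly]
  simp [Matrix.permanent, Fintype.card_perm]

/-- **The normal form, for a given affine representation.** If `A` is an affine `m × m` matrix
with `det A = per_n`, then `per_n(x + J) = n! · det(1 + diag(x ∘ κ) K)` for some
`K ∈ ℂ^{R × R}`, `κ : Fin R → Fin n × Fin n`, `R = n² m`. [folklore] -/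
theorem exists_repr_of_isAffineDetRepr {n m : ℕ}
    (A : Matrix (Fin m) (Fin m) (MvPolynomial (Fin n × Fin n) ℂ))
    (hA : ∀ i j, (A i j).totalDegree ≤ 1) (hdet : A.det = perPoly (Fin n) ℂ) :
    ∃ (K : Matrix (Fin (n ^ 2 * m)) (Fin (n ^ 2 * m)) ℂ) (κ : Fin (n ^ 2 * m) → Fin n × Fin n),
      aeval (fun e => X e + 1) (perPoly (Fin n) ℂ) =
        C (n.factorial : ℂ) * (1 + Matrix.diagonal (fun i => X (κ i)) *
          K.map (fun a : ℂ => (C a : MvPolynomial (Fin n × Fin n) ℂ))).det := by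
  -- the shifted matrix and its affine decomposition
  set φ : MvPolynomial (Fin n × Fin n) ℂ →ₐ[ℂ] MvPolynomial (Fin n × Fin n) ℂ :=
    aeval fun e => (X e + 1 : MvPolynomial (Fin n × Fin n) ℂ) with hφ
  set B : Matrix (Fin m) (Fin m) ℂ := A.map (eval fun _ => (1 : ℂ)) with hB
  set a : Fin n × Fin n → Matrix (Fin m) (Fin m) ℂ :=
    fun e => A.map (coeff (Finsupp.single e 1)) with ha
  have hshift : φ (perPoly (Fin n) ℂ) =
      (B.map C + ∑ e, (X e : MvPolynomial (Fin n × Fin n) ℂ) • (a e).map C :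
        Matrix (Fin m) (Fin m) (MvPolynomial (Fin n × Fin n) ℂ)).det := by
    rw [← hdet, AlgHom.map_det, AlgHom.mapMatrix_apply, hφ,
      map_aeval_X_add_one_of_totalDegree_le_one A hA]
  -- `det B = per_n(J) = n!`, so `B` is invertible
  have hBdet : B.det = (n.factorial : ℂ) := by
    have h := (RingHom.map_det (eval fun _ => (1 : ℂ)) A).symm
    rw [RingHom.mapMatrix_apply] at h
    rw [hB, h, hdet, eval_one_perPoly]
  have hBunit : IsUnit B.det := by
    rw [hBdet]
    exact isUnit_iff_ne_zero.2 (Nat.cast_ne_zero.2 (Nat.factorial_ne_zero n))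
  -- factor out `B`
  have hfactor : (B.map C + ∑ e, (X e : MvPolynomial (Fin n × Fin n) ℂ) • (a e).map C :
        Matrix (Fin m) (Fin m) (MvPolynomial (Fin n × Fin n) ℂ)) =
      B.map C * (1 + ∑ e, (X e : MvPolynomial (Fin n × Fin n) ℂ) • (B⁻¹ * a e).map C) := by
    rw [Matrix.mul_add, Matrix.mul_one, Matrix.mul_sum]
    congr 1
    refine Finset.sum_congr rfl fun e _ => ?_
    rw [Matrix.mul_smul, ← Matrix.map_mul, ← Matrix.mul_assoc, Matrix.mul_nonsing_inv _ hBunit,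
      Matrix.one_mul]
  -- Weinstein–Aronszajn and reindexing
  have hcard : Fintype.card ((Fin n × Fin n) × Fin m) = n ^ 2 * m := by
    simp only [Fintype.card_prod, Fintype.card_fin, sq]
  set ε : (Fin n × Fin n) × Fin m ≃ Fin (n ^ 2 * m) := Fintype.equivFinOfCardEq hcard with hε
  set K₀ : Matrix ((Fin n × Fin n) × Fin m) ((Fin n × Fin n) × Fin m) ℂ :=
    Matrix.of fun p q => (B⁻¹ * a q.1) p.2 q.2 with hK₀
  refine ⟨Matrix.reindex ε ε K₀, fun i => (ε.symm i).1, ?_⟩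
  have hre := congrArg Matrix.det
    (reindex_one_add_diagonal_mul ε (fun p : (Fin n × Fin n) × Fin m =>
      (X p.1 : MvPolynomial (Fin n × Fin n) ℂ)) K₀)
  rw [Matrix.det_reindex_self] at hre
  have hWA := det_one_add_sum_X_smul_map_C (R := ℂ) (fun e => B⁻¹ * a e)
  have hCdet : (B.map C : Matrix (Fin m) (Fin m) (MvPolynomial (Fin n × Fin n) ℂ)).det =
      C (n.factorial : ℂ) := by
    rw [← hBdet, RingHom.map_det, RingHom.mapMatrix_apply]
  rw [hshift, hfactor, Matrix.det_mul, hCdet, hWA, ← hK₀, hre]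
  rfl

end FreeFermionCLLTotalRankLeDc

/-- **`TotalRankLeDc` (item `stmt-ValiantsHypothesis-3784`).** For every `n` there is a
principal-minor representation `per_n(x + J) = n! · det(I_R + diag(x ∘ κ) K)` of size
`R ≤ n² · dc(per_n)` (Sylvester / Weinstein–Aronszajn normal form after the shift by `J`,
`per_n(J) = n! ≠ 0`; `dc` attained by `hasDetRepr_determinantalComplexity_holds`). -/
theorem TotalRankLeDc_proof :
    Summit.ValiantsHypothesis.ValiantsHypothesis.Theses.FreeFermionCLL.TotalRankLeDc := by
  unfold Summit.ValiantsHypothesis.ValiantsHypothesis.Theses.FreeFermionCLL.TotalRankLeDc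
  intro n
  obtain ⟨A, hA, hdet⟩ := hasDetRepr_determinantalComplexity_holds (perPoly (Fin n) ℂ)
  exact ⟨_, le_rfl, FreeFermionCLLTotalRankLeDc.exists_repr_of_isAffineDetRepr A hA hdet⟩

/-- **`TotalRankLeDc`, route `PrincipalMinorColouring` spelling** (the same item
`stmt-ValiantsHypothesis-3784`, shared verbatim between the two routes): the two route
declarations have syntactically identical bodies, so the proof above applies. -/
theorem PrincipalMinorColouring_TotalRankLeDc_proof :
    Summit.ValiantsHypothesis.ValiantsHypothesis.Theses.PrincipalMinorColouring.TotalRankLeDc :=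
  TotalRankLeDc_proof

end Summit.ValiantsHypothesis.ValiantsHypothesis.Theorems
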